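import Summits.QuantumFields.YangMills.Theorems.UnitScaleTiltProp8FlatPortDistance
import Literature.MathematicalPhysics.QuantumFieldTheory.Balaban1983to89.B6Cor28KLevelV1
import Literature.MathematicalPhysics.QuantumFieldTheory.Balaban1983to89.B11B3
import HarnessLib

/-!
# Route `UnitScaleTilt`, crux K1 child «MinimiserStabilityRegPr» (stmt-QuantumFields-19200), v8 pillar **P2 `stub_flatOpsCubeSeq`** — THE PORT BRIDGE, file 5:
# **THE (162) ROW SUM `FlatCubeOpsText.RowSum162` HOLDS AT EVERY CHARTED FAMILY `domT hN D hk` OVER THE PORT's DISTANCE `dBI := d_T + 3`**, k-UNIFORMLY: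
# `(L^{j(b)}η)·Σ_c e^{−½δ₀(d+3)}(d + 4)(L^{j(c)}η)⁻¹ ≤ B₃(L, δ₀, N₀)` — [Balaban1985Variational] p. 303 *«It follows from the inequalities (2.47)–(2.51) of [3] that B₃
# depends on d and L only»*, here from lit-balaban's torus Lemma 2.1 `B6Geom246MultiLevelTorus.lemma21_torus` ((2.61), constant `K261`) and r03's level absorption
# `B6Cor28KLevelV1.powL_lgap_le` ((2.60): the factor `L^{j(b)−j(c)}` costs `e^{(δ₀/8)·d}` once `L·e^{−(δ₀/8)(R·L·M_h − 1)} ≤ 1`), summed over carrier blocks by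
# `B6Cor28KLevelV1.sum_comp_beta_le`

Cell `ym3-torus` (HUMAN RULING D-0037, YM ladder rung R3), seat `ym3-torus-p1` gen 17.  `--supports stmt-QuantumFields-19200 --as helper`; count-neutral; def-free.

WHAT IS PROVED (sorry-free; axioms standard; no definition).  At the d = 3 carrier `F = ⟨ℓ+1, hL, m, hm⟩`, `k = K − n ≥ 1`, a torus family `D : TDomains 2 ℓ M_h (K−n) P′ R`
(`hN`, `M_h ≥ 1`, `P′ ≥ 1`), a rate `δ₀ > 0`, a Lemma-2.1 budget `N₀ ≥ 1` with `N₀ + 1 ≤ R·L·M_h` and the (2.59)-shape threshold `e^{−δ₀/4}·L^{6/N₀} < 1`, and the absorption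
threshold `L·e^{−(δ₀/8)(R·L·M_h − 1)} ≤ 1`:
* `add_four_mul_exp_neg_le` (`(t + 4)e^{−st} ≤ 1/(es) + 4`), `pow_div_pow_le_pow_lgap` (`L^{j}/L^{j′} ≤ L^{|j−j′|}`);
* **`rowSum162_domT`**: `RowSum162 F n K (domT hN D hk) (d_T + 3) w δ₀ B₃` for every P2 weight family `w`, with the EXPLICIT
  `B₃ = 6·L·(8/(e·δ₀) + 4)·K261 N₀ 3 L 1 (δ₀/4)` — a function of `L, δ₀, N₀` only (k-, volume- and family-uniform).
HONEST SCOPE: bookkeeping over landed certificates; the two thresholds are the «R M sufficiently large» of print ((163), (2.59)), discharged by the choice of `R₀, M₀` in the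
assembly file.  NOT a claim about the mass gap.

References: T. Bałaban, CMP **102** (1985) 277–309 [Balaban1985Variational] (161)–(163) p.303; CMP **96** (1984) 223–250 [Balaban1984PropagatorsII] Lemma 2.1 (2.59)–(2.63) p.233–234, (2.46) p.231.
-/

set_option autoImplicit false

noncomputable section

open scoped BigOperators

namespace Summit.QuantumFields.YangMills.Theorems.FlatPortRowSum

open Literature.MathematicalPhysics.QuantumFieldTheory.Balaban1983to89
open B6MultiLevelBoxOperator (N0)
open B6MultiLevelTorusOperator (TDomains)
open B6Geom246MultiLevelBox (bset)
open B6Geom246MultiLevelTorus (geomT bondT lemma21_torus)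
open B6GlobalChartV1 (PV toBox blkV1 domT)
open B6Ineq2142KLevelV1 (lvl lvl_le β beta_level)
open B6Ineq281MultiLevelBox (lgap)
open B6Ineq261LevelGap (K261 K261_nonneg)
open B6Prop26KLevelAssemblyV1 (distT_nonneg)
open B6Cor28KLevelV1 (powL_lgap_le sum_comp_beta_le)
open B6SectAOperatorsV1 (BondIdx)
open B11Eq115Space (levOf)
open T3ContinuumYM3Torus (T3Family)
open FlatCubeOpsText (IsLevWeight RowSum162)
open FlatPortDistance (levOf_domT blkV1_level)

/-! ## §1 Two pieces of arithmetic -/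

/-- `(t + 4)·e^{−st} ≤ 1/(e·s) + 4` for `t ≥ 0`, `s > 0`. [folklore] -/
theorem add_four_mul_exp_neg_le {s t : ℝ} (hs : 0 < s) (ht : 0 ≤ t) : (t + 4) * Real.exp (-(s * t)) ≤ 1 / (Real.exp 1 * s) + 4 := by
  have h1 := B11B3.add_one_mul_exp_neg_le hs ht
  have h2 : Real.exp (-(s * t)) ≤ 1 := by rw [Real.exp_le_one_iff]; nlinarith
  have h3 : 0 ≤ Real.exp (-(s * t)) := (Real.exp_pos _).le
  nlinarith

/-- `L^{j}/L^{j′} ≤ L^{|j − j′|}` for `L ≥ 1`. [folklore] -/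
theorem pow_div_pow_le_pow_natAbs {L : ℝ} (hL : 1 ≤ L) (j j' : ℕ) : L ^ j / L ^ j' ≤ L ^ (Int.natAbs ((j : ℤ) - j')) := by
  have hL0 : 0 < L := lt_of_lt_of_le zero_lt_one hL
  rw [div_le_iff₀ (pow_pos hL0 _), ← pow_add]
  exact pow_le_pow_right₀ hL (by omega)

/-! ## §2 The row sum at a charted family -/

section Carrier

variable (ℓ : ℕ) (hL : Odd (ℓ + 1) ∧ 1 < ℓ + 1) (m : ℕ) (hm : 1 ≤ m) (n K : ℕ)
variable {Mh R : ℕ} {P' : Fin (2 + 1) → ℕ}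
variable (hN : ∀ μ, N0 ℓ Mh (K - n) P' μ = (PV 2 ℓ m K (by norm_num) hL).sitesPerDir 0) (D : TDomains 2 ℓ Mh (K - n) P' R) (hk : K - n ≤ m + K)

/-- **(162) AT THE CHARTED FAMILY, OVER `dBI := d_T + 3`, k-UNIFORMLY** — `RowSum162 F n K (domT hN D hk) (d_T + 3) w δ₀ B₃` with
`B₃ = 6·L·(8/(e·δ₀) + 4)·K261 N₀ 3 L 1 (δ₀/4)`, under the two «R M large» thresholds. [cite: Balaban1985Variational, (162)-(163) p.303; Balaban1984PropagatorsII, Lemma 2.1 (2.60)-(2.61) p.234] -/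
theorem rowSum162_domT (hk1 : 1 ≤ K - n) (hMh : 1 ≤ Mh) (hP : ∀ μ, 1 ≤ P' μ) {δ₀ : ℝ} (hδ₀ : 0 < δ₀) {N₀ : ℕ} (hN₀ : 0 < N₀)
    (hRM : N₀ + 1 ≤ R * ((ℓ + 1) * Mh)) (hθ : Real.exp (-(1 / 4 * δ₀)) * ((ℓ : ℝ) + 1) ^ ((2 * (2 + 1 : ℕ) : ℝ) / N₀) < 1)
    (hsmall : ((ℓ : ℝ) + 1) ^ 1 * Real.exp (-(δ₀ / 8 * ((R : ℝ) * (((ℓ : ℝ) + 1) * Mh) - 1))) ≤ 1)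
    (w : ℕ → PBond (PV 2 ℓ m K (by norm_num) hL) 0 → ℝ) (hw : IsLevWeight (⟨ℓ + 1, hL, m, hm⟩ : T3Family) n K (domT (hd := by norm_num) hN D hk) w) :
    RowSum162 (⟨ℓ + 1, hL, m, hm⟩ : T3Family) n K (domT (hd := by norm_num) hN D hk)
      (fun b c => ((bondT D).dist (blkV1 hN D b) (β hN D hk c) : ℝ) + 3) w δ₀
      (6 * ((ℓ : ℝ) + 1) * (1 / (Real.exp 1 * (δ₀ / 8)) + 4) * K261 N₀ (2 + 1) ((ℓ : ℝ) + 1) 1 (1 / 4 * δ₀)) := by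
  intro b
  -- notation
  set Lr : ℝ := (ℓ : ℝ) + 1 with hLr
  have hL1 : (1 : ℝ) ≤ Lr := by rw [hLr]; linarith [(Nat.cast_nonneg ℓ : (0 : ℝ) ≤ ℓ)]
  have hL0 : (0 : ℝ) < Lr := lt_of_lt_of_le zero_lt_one hL1
  have hcast : (((ℓ + 1 : ℕ) : ℝ)) = Lr := by rw [hLr]; push_cast; ring
  set y := blkV1 hN D b with hy
  set C8 : ℝ := 1 / (Real.exp 1 * (δ₀ / 8)) + 4 with hC8
  have hC80 : 0 ≤ C8 := by have := Real.exp_pos 1; rw [hC8]; positivity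
  set c1 : ℝ := K261 N₀ (2 + 1) Lr 1 (1 / 4 * δ₀) with hc1
  have hc10 : 0 ≤ c1 := K261_nonneg hL0.le zero_le_one
  -- (2.61) at rate `δ₀/4` and the level absorption (2.60)
  obtain ⟨-, h261, -, -⟩ := lemma21_torus (D := D) hMh hP hN₀ hRM hδ₀.le (by norm_num : (0 : ℝ) ≤ 1 / 4) (by norm_num : (1 : ℝ) / 4 ≤ 1) hθ
  have hRM1 : 1 ≤ R * ((ℓ + 1) * Mh) := le_trans (by omega) hRM
  have habs := powL_lgap_le D hMh hP hRM1 1 (by positivity : (0 : ℝ) ≤ δ₀ / 8) hsmall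
  -- the weight `w 1 b = L^{j(b)}·L^{−(K−n)}`
  have hFL : ((((⟨ℓ + 1, hL, m, hm⟩ : T3Family).L : ℕ) : ℝ)) = Lr := hcast
  have hw1 : w 1 b = Lr ^ D.lev (toBox hN b.src : Fin (2 + 1) → ℤ) * (Lr⁻¹) ^ (K - n) := by
    have hlev : levOf (fun j => {x : Site ((⟨ℓ + 1, hL, m, hm⟩ : T3Family).P K) 0 | (domT (hd := by norm_num) hN D hk).InOm j x}) (K - n) b.src =
        D.lev (toBox hN b.src : Fin (2 + 1) → ℤ) := levOf_domT (hd := by norm_num) hN D hk b.src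
    rw [hw 1 b, pow_one, hFL]
    -- the implicit `Params` of the level set is `F.P K` (defeq, not syntactically, `PV …`): close by `congrArg` at default transparency
    exact congrArg (fun e : ℕ => Lr ^ e * (Lr⁻¹) ^ (K - n)) hlev
  -- termwise bound: `w₁(b)·e^{−½δ₀(d+3)}(d+4)L^{(K−n)−j(c)} ≤ L·C₈·e^{−(δ₀/4)d}`
  have hterm : ∀ c : BondIdx (domT (hd := by norm_num) hN D hk),
      w 1 b * (Real.exp (-(δ₀ / 2 * (((bondT D).dist y (β hN D hk c) : ℝ) + 3))) * ((((bondT D).dist y (β hN D hk c) : ℝ) + 3) + 1) *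
        ((((⟨ℓ + 1, hL, m, hm⟩ : T3Family).L : ℕ) : ℝ) ^ ((K - n) - (c.1.1 : ℕ)))) ≤
      Lr * C8 * Real.exp (-(1 / 4 * δ₀ * (geomT D).dist y (β hN D hk c))) := by
    intro c
    set t : ℝ := ((bondT D).dist y (β hN D hk c) : ℝ) with ht
    have ht0 : 0 ≤ t := Nat.cast_nonneg _
    have hdist : (geomT D).dist y (β hN D hk c) = t := rfl
    have hjc : (c.1.1 : ℕ) ≤ K - n := lvl_le hN D hk c
    -- the level factor `L^{j(b)}·L^{−k}·L^{k−j(c)} = L^{j(b)}/L^{j(c)} ≤ L^{|j(b)−j(c)|} ≤ L·e^{(δ₀/8)t}`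
    have hLfac : w 1 b * ((((⟨ℓ + 1, hL, m, hm⟩ : T3Family).L : ℕ) : ℝ) ^ ((K - n) - (c.1.1 : ℕ))) ≤ Lr * Real.exp (δ₀ / 8 * t) := by
      rw [hw1, hFL]
      have e2 : Lr ^ D.lev (toBox hN b.src : Fin (2 + 1) → ℤ) * (Lr⁻¹) ^ (K - n) * Lr ^ ((K - n) - (c.1.1 : ℕ)) =
          Lr ^ D.lev (toBox hN b.src : Fin (2 + 1) → ℤ) / Lr ^ (c.1.1 : ℕ) := by
        rw [inv_pow, eq_div_iff (pow_ne_zero _ hL0.ne'), mul_assoc, mul_assoc, ← pow_add, Nat.sub_add_cancel hjc, inv_mul_cancel₀ (pow_ne_zero _ hL0.ne'), mul_one]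
      rw [e2]
      have hgap : Lr ^ D.lev (toBox hN b.src : Fin (2 + 1) → ℤ) / Lr ^ (c.1.1 : ℕ) ≤ Lr ^ lgap D.toDomains y (β hN D hk c) := by
        have := pow_div_pow_le_pow_natAbs hL1 (D.lev (toBox hN b.src : Fin (2 + 1) → ℤ)) (c.1.1 : ℕ)
        have hlg : lgap D.toDomains y (β hN D hk c) = Int.natAbs ((D.lev (toBox hN b.src : Fin (2 + 1) → ℤ) : ℤ) - (c.1.1 : ℕ)) := by
          unfold lgap
          rw [hy, blkV1_level, beta_level hN D hk hk1 c]
        rw [hlg]; exact this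
      have habs' := habs y (β hN D hk c)
      rw [pow_one] at habs'
      rw [hdist] at habs'
      exact hgap.trans habs'
    -- the exponential factor
    have hexp3 : Real.exp (-(δ₀ / 2 * (t + 3))) ≤ Real.exp (-(δ₀ / 2 * t)) := Real.exp_le_exp.2 (by nlinarith)
    have hsplit : Real.exp (-(δ₀ / 2 * t)) = Real.exp (-(δ₀ / 8 * t)) * Real.exp (-(δ₀ / 8 * t)) * Real.exp (-(1 / 4 * δ₀ * t)) := by
      rw [← Real.exp_add, ← Real.exp_add]; congr 1; ring
    have hpoly : (t + 3 + 1) * Real.exp (-(δ₀ / 8 * t)) ≤ C8 := by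
      have := add_four_mul_exp_neg_le (s := δ₀ / 8) (by positivity) ht0
      rw [hC8]; convert this using 2; ring
    have hcancel : Real.exp (δ₀ / 8 * t) * Real.exp (-(δ₀ / 8 * t)) = 1 := by rw [← Real.exp_add, add_neg_cancel, Real.exp_zero]
    -- assemble
    have hA : 0 ≤ Real.exp (-(δ₀ / 2 * (t + 3))) * (t + 3 + 1) := by positivity
    calc w 1 b * (Real.exp (-(δ₀ / 2 * (t + 3))) * (t + 3 + 1) * ((((⟨ℓ + 1, hL, m, hm⟩ : T3Family).L : ℕ) : ℝ) ^ ((K - n) - (c.1.1 : ℕ))))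
        = (w 1 b * ((((⟨ℓ + 1, hL, m, hm⟩ : T3Family).L : ℕ) : ℝ) ^ ((K - n) - (c.1.1 : ℕ)))) * (Real.exp (-(δ₀ / 2 * (t + 3))) * (t + 3 + 1)) := by ring
      _ ≤ (Lr * Real.exp (δ₀ / 8 * t)) * (Real.exp (-(δ₀ / 2 * t)) * (t + 3 + 1)) := by
          refine mul_le_mul hLfac (mul_le_mul_of_nonneg_right hexp3 (by linarith)) hA (by positivity)
      _ = Lr * ((t + 3 + 1) * Real.exp (-(δ₀ / 8 * t))) * (Real.exp (δ₀ / 8 * t) * Real.exp (-(δ₀ / 8 * t))) * Real.exp (-(1 / 4 * δ₀ * t)) := by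
          rw [hsplit]; ring
      _ ≤ Lr * C8 * 1 * Real.exp (-(1 / 4 * δ₀ * t)) := by
          rw [hcancel]
          exact mul_le_mul_of_nonneg_right (mul_le_mul_of_nonneg_right (mul_le_mul_of_nonneg_left hpoly hL0.le) zero_le_one) (Real.exp_pos _).le
      _ = Lr * C8 * Real.exp (-(1 / 4 * δ₀ * (geomT D).dist y (β hN D hk c))) := by rw [mul_one, hdist]
  -- sum over the index bonds: carrier blocks (fibres ≤ 2D = 6) and (2.61)
  have hsum := sum_comp_beta_le hN D hk hk1 (g := fun y' => Lr * C8 * Real.exp (-(1 / 4 * δ₀ * (geomT D).dist y y'))) (fun y' => by positivity)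
  have h261y := h261 y
  calc w 1 b * ∑ c, Real.exp (-(δ₀ / 2 * (((bondT D).dist (blkV1 hN D b) (β hN D hk c) : ℝ) + 3))) *
          ((((bondT D).dist (blkV1 hN D b) (β hN D hk c) : ℝ) + 3) + 1) * ((((⟨ℓ + 1, hL, m, hm⟩ : T3Family).L : ℕ) : ℝ)) ^ ((K - n) - (c.1.1 : ℕ))
      = ∑ c, w 1 b * (Real.exp (-(δ₀ / 2 * (((bondT D).dist y (β hN D hk c) : ℝ) + 3))) * ((((bondT D).dist y (β hN D hk c) : ℝ) + 3) + 1) *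
          ((((⟨ℓ + 1, hL, m, hm⟩ : T3Family).L : ℕ) : ℝ) ^ ((K - n) - (c.1.1 : ℕ)))) := by rw [Finset.mul_sum]
    _ ≤ ∑ c, Lr * C8 * Real.exp (-(1 / 4 * δ₀ * (geomT D).dist y (β hN D hk c))) := Finset.sum_le_sum fun c _ => hterm c
    _ ≤ 2 * ((2 : ℝ) + 1) * ∑ y', Lr * C8 * Real.exp (-(1 / 4 * δ₀ * (geomT D).dist y y')) := hsum
    _ = 2 * ((2 : ℝ) + 1) * (Lr * C8) * ∑ y', Real.exp (-(1 / 4 * δ₀ * (geomT D).dist y y')) := by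
        conv_lhs => rw [← Finset.mul_sum]
        ring
    _ ≤ 2 * ((2 : ℝ) + 1) * (Lr * C8) * c1 := mul_le_mul_of_nonneg_left h261y (by positivity)
    _ = 6 * Lr * C8 * c1 := by ring

end Carrier

end Summit.QuantumFields.YangMills.Theorems.FlatPortRowSum

end
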